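import Summits.HubbardSuperconductivity.HubbardSuperconductivity.Theorems.FunctionFieldCertificateMesoscopicPairOrderNecessity

/-!
# Crux `MesoscopicPairOrder` (item `stmt-HubbardSuperconductivity-7331`): the local-pair-weight ceiling on the margin

Negative-side calibration lemma of the standing disprover (cdisprove cycle 1), sorry-free; workfile
`Cruxes/MesoscopicPairOrder/Disproof.lean`, companions `Negative/LoadBearing.lean`,
`Negative/SaturatedExclusion.lean`.  The crux asks at one `(U, δ)` for `m R² ≤ T_R(ψ)/L²`,
`T_R(ψ) = Σ_{x,y} Πᵢ (1 - |(y-x)ᵢ|_L/R)₊ Re⟨P_x ψ, P_y ψ⟩`, in every normalised sector ground state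
at arbitrarily large scales `R`.  The tree's Fejér FLOOR `R² ‖Δ_d ψ‖²/L² ≤ T_R(ψ)`
(`fejerBox_floor_pairField`) bounds `T_R` below by the `k = 0` mode; here is the matching CEILING:

* `boxSum_le_sq_mul_localWeight` — `T_R(ψ) ≤ R² Σ_x ‖P_x ψ‖²` for `0 < R`, `2R ≤ L` (tent identity
  `R² T_R(ψ) = Σ_a ‖B_a ψ‖²` of `FunctionFieldCertificateAssembly.re_sum_star_blockMulVec_dotProduct_eq`
  plus Cauchy–Schwarz over the `R²` offsets of a block).
* `localWeight_ge_margin_of_pointwise` — hence if the crux body holds at `(U, δ)` with margin `m`,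
  then for all large even `L` EVERY normalised sector ground state has local `d`-wave pair weight
  `L⁻² Σ_x ‖P_x ψ‖² ≥ m`: the margin is at most the eventual minimum, over all sector ground states,
  of the local pair weight (`≤ 32` by `‖P_x‖² ≤ 32`; in spin language at most `8 ×` the
  nearest-neighbour singlet density `L⁻² Σ_{⟨xy⟩} ⟨n_x n_y/4 - S_x·S_y⟩`, since
  `b_{xy}ᴴ b_{xy} = 2(n_x n_y/4 - S_x·S_y)` for `b_{xy} = c_{x↑}c_{y↓} - c_{x↓}c_{y↑}` — the spin identity
  is not formalised here).  A ground state anywhere in the sequence with vanishing local singlet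
  density (e.g. a saturated ferromagnet, `Negative/SaturatedExclusion.lean`) forces `m = 0`.

Sources: Kennedy–Lieb–Shastry, PRL 61 (1988) 2582 (block/Parseval bookkeeping); Stein–Shakarchi,
*Fourier Analysis*, Ch. 2 (Fejér kernel); D. J. Scalapino, Phys. Rep. 250 (1995) 329, §2; folklore.
-/

noncomputable section

namespace Summit.HubbardSuperconductivity.HubbardSuperconductivity.Theorems.MesoscopicPairOrder.Negative

open Matrix Finset Filter
open Literature.Probability.LatticeModels Literature.MathematicalPhysics.QuantumLattice
open scoped ComplexOrder

/-- Scalar block reindexing on the torus: `Σ_a Σ_{u ∈ [0,R)²} f(a + u) = R² Σ_x f(x)`. [folklore] -/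
theorem sum_sum_block_eq {L : ℕ} [NeZero L] (R : ℕ) (f : TorusSite 2 L → ℝ) :
    ∑ a : TorusSite 2 L, ∑ u : Fin 2 → Fin R, f (a + fun i => ((u i : ℕ) : ZMod L)) =
      (R : ℝ) ^ 2 * ∑ x : TorusSite 2 L, f x := by
  rw [Finset.sum_comm]
  have h : ∀ u : Fin 2 → Fin R,
      ∑ a : TorusSite 2 L, f (a + fun i => ((u i : ℕ) : ZMod L)) = ∑ x : TorusSite 2 L, f x :=
    fun u => Fintype.sum_equiv (Equiv.addRight _) _ _ fun a => rfl
  simp_rw [h]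
  rw [Finset.sum_const, Finset.card_univ, Fintype.card_fun, Fintype.card_fin, Fintype.card_fin,
    nsmul_eq_mul, Nat.cast_pow]

/-- **CEILING `T_R(ψ) ≤ R² Σ_x ‖P_x ψ‖²`** (`0 < R`, `2R ≤ L`): the tent identity
`R² T_R(ψ) = Σ_a ‖B_a ψ‖²` (tree: `FunctionFieldCertificateAssembly.re_sum_star_blockMulVec_dotProduct_eq`,
blocks `B_a = Σ_{u ∈ [0,R)²} P_{a+u}`) and Cauchy–Schwarz `‖B_a ψ‖² ≤ R² Σ_u ‖P_{a+u} ψ‖²`. Together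
with the Fejér FLOOR `R² ‖Δ_d ψ‖²/L² ≤ T_R(ψ)` (`fejerBox_floor_pairField`) this sandwiches the crux's
functional between the `k = 0` mode and the local pair weight. [folklore] -/
theorem boxSum_le_sq_mul_localWeight (L : ℕ) [NeZero L] (R : ℕ) (hR : 0 < R) (hRL : 2 * R ≤ L)
    (ψ : Fock (Orb (FermionTorus 2 L))) :
    (∑ x : TorusSite 2 L, ∑ y : TorusSite 2 L,
        (∏ i : Fin 2, max 0 (1 - |(((y i - x i).valMinAbs : ℤ) : ℝ)| / (R : ℝ))) *
          (star (localPair dWaveFormFactor L x *ᵥ ψ) ⬝ᵥ (localPair dWaveFormFactor L y *ᵥ ψ)).re) ≤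
      (R : ℝ) ^ 2 * ∑ x : TorusSite 2 L,
      (star (localPair dWaveFormFactor L x *ᵥ ψ) ⬝ᵥ (localPair dWaveFormFactor L x *ᵥ ψ)).re := by
  have htent := Theorems.FunctionFieldCertificateAssembly.re_sum_star_blockMulVec_dotProduct_eq
    (L := L) R hR hRL (localPair dWaveFormFactor L) ψ
  have hCS : ∀ a : TorusSite 2 L,
      (star ((∑ u : Fin 2 → Fin R, localPair dWaveFormFactor L (a + fun i => ((u i : ℕ) : ZMod L))) *ᵥ ψ) ⬝ᵥ
          ((∑ u : Fin 2 → Fin R, localPair dWaveFormFactor L (a + fun i => ((u i : ℕ) : ZMod L))) *ᵥ ψ)).re ≤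
        (R : ℝ) ^ 2 * ∑ u : Fin 2 → Fin R,
          (star (localPair dWaveFormFactor L (a + fun i => ((u i : ℕ) : ZMod L)) *ᵥ ψ) ⬝ᵥ
            (localPair dWaveFormFactor L (a + fun i => ((u i : ℕ) : ZMod L)) *ᵥ ψ)).re := by
    intro a
    rw [Matrix.sum_mulVec]
    have h := Theorems.FunctionFieldCertificate.re_star_sum_dotProduct_sum_le
      (fun u : Fin 2 → Fin R => localPair dWaveFormFactor L (a + fun i => ((u i : ℕ) : ZMod L)) *ᵥ ψ)
    rwa [Fintype.card_fun, Fintype.card_fin, Fintype.card_fin, Nat.cast_pow] at h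
  have hsum : (∑ a : TorusSite 2 L,
      star ((∑ u : Fin 2 → Fin R, localPair dWaveFormFactor L (a + fun i => ((u i : ℕ) : ZMod L))) *ᵥ ψ) ⬝ᵥ
        ((∑ u : Fin 2 → Fin R, localPair dWaveFormFactor L (a + fun i => ((u i : ℕ) : ZMod L))) *ᵥ ψ)).re ≤
      (R : ℝ) ^ 2 * ((R : ℝ) ^ 2 * ∑ x : TorusSite 2 L,
        (star (localPair dWaveFormFactor L x *ᵥ ψ) ⬝ᵥ (localPair dWaveFormFactor L x *ᵥ ψ)).re) := by
    rw [Complex.re_sum, ← sum_sum_block_eq R (fun x => (star (localPair dWaveFormFactor L x *ᵥ ψ) ⬝ᵥ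
      (localPair dWaveFormFactor L x *ᵥ ψ)).re), Finset.mul_sum]
    exact Finset.sum_le_sum fun a _ => hCS a
  rw [htent] at hsum
  have hR2 : (0 : ℝ) < (R : ℝ) ^ 2 := by positivity
  exact le_of_mul_le_mul_left hsum hR2

/-- **The margin is at most the eventual minimal LOCAL pair density of the ground states**:
if the crux body holds at `(U, δ)` with margin `m`, then for all large even `L` every normalised
sector ground state has local `d`-wave pair weight `s₀(ψ) := L⁻² Σ_x ‖P_x ψ‖² ≥ m`. (So `m ≤ 32`
trivially, `‖P_x‖² ≤ 32`; and since `‖P_x ψ‖² ≤ 2 Σ_e ‖b_{x,x+e} ψ‖²` with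
`b_{xy}ᴴ b_{xy} = 2(n_x n_y/4 - S_x·S_y)`, `m ≤ 8 L⁻² Σ_{⟨xy⟩} ⟨n_x n_y/4 - S_x·S_y⟩_ψ`: the margin
is controlled by the nearest-neighbour SINGLET density of every ground state — a calibration, not an
obstruction; the spin identity is not formalised here.) [folklore] -/
theorem localWeight_ge_margin_of_pointwise {U δ : ℝ}
    (h : ∃ m : ℝ, 0 < m ∧ ∀ R₀ : ℕ, ∃ R : ℕ, R₀ ≤ R ∧ ∃ L₀ : ℕ, ∀ (L : ℕ) [NeZero L], L₀ ≤ L → Even L →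
      ∀ ψ : Fock (Orb (FermionTorus 2 L)), star ψ ⬝ᵥ ψ = 1 →
        IsGroundStateInSector (hubbardTorus 2 L 1 U) (2 * ⌊(1 - δ) * (L : ℝ) ^ 2 / 2⌋₊) 0 ψ →
          m * (R : ℝ) ^ 2 ≤ (∑ x : TorusSite 2 L, ∑ y : TorusSite 2 L,
            (∏ i : Fin 2, max 0 (1 - |(((y i - x i).valMinAbs : ℤ) : ℝ)| / (R : ℝ))) *
              (star (localPair dWaveFormFactor L x *ᵥ ψ) ⬝ᵥ (localPair dWaveFormFactor L y *ᵥ ψ)).re) /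
                (L : ℝ) ^ 2) :
    ∃ m : ℝ, 0 < m ∧ ∃ L₁ : ℕ, ∀ (L : ℕ) [NeZero L], L₁ ≤ L → Even L →
      ∀ ψ : Fock (Orb (FermionTorus 2 L)), star ψ ⬝ᵥ ψ = 1 →
        IsGroundStateInSector (hubbardTorus 2 L 1 U) (2 * ⌊(1 - δ) * (L : ℝ) ^ 2 / 2⌋₊) 0 ψ →
          m ≤ (∑ x : TorusSite 2 L,
            (star (localPair dWaveFormFactor L x *ᵥ ψ) ⬝ᵥ (localPair dWaveFormFactor L x *ᵥ ψ)).re) /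
              (L : ℝ) ^ 2 := by
  obtain ⟨m, hm, hall⟩ := h
  obtain ⟨R, hR, L₀, hL⟩ := hall 1
  refine ⟨m, hm, max L₀ (2 * R), fun L _ hL₁ hE ψ hψ hgs => ?_⟩
  have hRpos : 0 < R := hR
  have hRL : 2 * R ≤ L := le_of_max_le_right hL₁
  have hbody := hL L (le_of_max_le_left hL₁) hE ψ hψ hgs
  have hceil := boxSum_le_sq_mul_localWeight L R hRpos hRL ψ
  have hLpos : (0 : ℝ) < L := Nat.cast_pos.2 (Nat.pos_of_ne_zero (NeZero.ne L))
  have hL2 : (0 : ℝ) < (L : ℝ) ^ 2 := by positivity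
  rw [le_div_iff₀ hL2] at hbody ⊢
  have hR2 : (0 : ℝ) < (R : ℝ) ^ 2 := by positivity
  -- `m R² L² ≤ T_R ≤ R² · S`, divide by `R²`
  have : (R : ℝ) ^ 2 * (m * (L : ℝ) ^ 2) ≤ (R : ℝ) ^ 2 * ∑ x : TorusSite 2 L,
      (star (localPair dWaveFormFactor L x *ᵥ ψ) ⬝ᵥ (localPair dWaveFormFactor L x *ᵥ ψ)).re := by
    nlinarith
  exact le_of_mul_le_mul_left this hR2

end Summit.HubbardSuperconductivity.HubbardSuperconductivity.Theorems.MesoscopicPairOrder.Negative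

end
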